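import Summits.BirchSwinnertonDyer.BirchSwinnertonDyer.Theorems.GenusKolyvaginAtTwoShaRatCardOfKFour
import Summits.BirchSwinnertonDyer.BirchSwinnertonDyer.Theorems.GenusKolyvaginAtTwoShaConsistencyLawFreeCurrency
import Summits.BirchSwinnertonDyer.BirchSwinnertonDyer.Theorems.GenusKolyvaginAtTwoGenusDeepSupplyAtTwoNegDiscNarrowKFourCellShaCardCurrency
import HarnessLib

/-!
# Route `GenusKolyvaginAtTwo`, cruxes K₄⁺ `K4Pos` (stmt-BirchSwinnertonDyer-31469) / K₄ `K4Neg` (stmt-BirchSwinnertonDyer-31526):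
# THE CASSELS–TATE CRITERION FOR K₄ — on the cut cell, mod Q2, a witness EXISTS iff the Cassels–Tate pairing of `Ш(E/ℚ)` vanishes identically
# between `Ш(E/ℚ)[2^(M₀−1)]` and `Ш(E/ℚ)[2]` (at `M₀ = 2`: iff Cassels–Tate is `≡ 0` on `Ш(E/ℚ)[2] × Ш(E/ℚ)[2]`)

Seat `bsd-line-gk2-p4` g29 (cell `bsd-f1-sign2`), WIDTH-5 attach on route `GenusKolyvaginAtTwo` rev 59; sequel of `…ShaRatCardOfKFour` (p774700).
THEOREMS ONLY (no definition, no named fact, no `sorry`); standard axioms.  **BSD is NOT proved by this file; K4Pos / K4Neg are NOT proved; no item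
is closed.**  CONDITIONAL on Q2 `KolyvaginRelationAtTwo` (24880) where displayed.  This is LEAD-BRIEF-g23-ADDENDUM B.4's INSTRUMENT («at `M₀ = 2`,
K₄ at `E` ⟺ the Cassels–Tate pairing on `Sel₂(E/ℚ) ≅ Ш(E/ℚ)[2]` is identically zero; general `M₀`: the iterated pairings vanish») as a KERNEL
equivalence, in general-`M₀` closed form; offered to the LEAD (bus 14:0xZ), who named the depth-two instrument as candidate (iv).

MECHANISM.  By `…ShaRatCardOfKFour` §0b, on the cut cell `Y = Ш(E/ℚ)[2^∞] ≃ ℤ/2^e × ℤ/2^e` with `1 ≤ e ≤ M₀`, and K₄ ⟺ `e = M₀` (§3 there /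
p773982 / LEAD p773559).  For ANY bi-additive `B` on `Ш(E/ℚ)` that is alternating with kernel the divisible subgroup (a «Cassels–Tate-type» pairing:
the tree's `WeierstrassCurve.exists_casselsTate_pairing_holds` provides one; THE canonical pairing is one) `B` is non-degenerate on the finite `Y`
(`OneBit.eq_zero_of_forall_apply_primaryComponent_eq_zero`), and on `(ℤ/2^e)²`:
  **`B(Y[2^k], Y[2]) ≡ 0 ⟺ k + 1 ≤ e`** (§1–§2: «⇐» every `a ∈ Y[2^k]` is a double when `k < e`, so `B(a, b) = B(a′, 2b) = 0`; «⇒» if `e ≤ k`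
  then `Y[2^k] = Y` and the non-zero `2`-torsion class `f⁻¹(2^(e−1), 0)` would be `B`-orthogonal to `Y`).
Hence (§3) **K₄ ⟺ `B(Ш(E/ℚ)[2^(M₀−1)], Ш(E/ℚ)[2]) ≡ 0`** for every / for some Cassels–Tate-type `B` — a per-curve higher-descent test (Cassels:
`⟨x, Ш[2]⟩ = 0 ⟺ x ∈ 2Ш`; Magma `CasselsTatePairing` on `2`-coverings at `M₀ = 2`), BSD-predicted on every K₄/K₄⁺ census cell.

* §1 `ZModPow.exists_two_nsmul_of_two_pow_nsmul_eq_zero` & co. — arithmetic in `ℤ/2^e × ℤ/2^e`.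
* §2 `forall_apply_eq_zero_iff_of_addEquiv_zmod_prod` — the criterion for a pairing on `↥Ш` non-degenerate-on-`Y`, `Y ≃ (ℤ/2^e)²`.
* §3 ★ `kFourPos_witness_iff_casselsTate_orthogonal` (K₄⁺ cut cell, mod Q2): witness ↔ (∀ CT-type `B`, `B(Ш[2^(M₀−1)], Ш[2]) = 0`);
  `kFourPos_witness_iff_exists_casselsTate_orthogonal`: ↔ (∃ CT-type `B` with that vanishing).  The Δ<0 analogue follows the same way from
  the LEAD's `kFourNeg_conclusion_iff_natCard_sha_rat_eq_pow` (p773559) + `exists_addEquiv_shaPrimary_of_kFourNeg_cut`; stated as §4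
  `natCard_shaPrimary_rat_eq_pow_iff_casselsTate_orthogonal_of_kFourNeg_cut` in cardinality form, and as §4 ★
  `kFourNeg_witness_iff_casselsTate_orthogonal` on K4Neg's binders VERBATIM + cut (composed with the LEAD's p773559 `↔`; LEAD GO, bus 13:17Z).

References: [Cassels1962ArithmeticIV] §1, Thm. 1.1; [MilneADT2006] I Thm. 6.13; [McCallumLMS1991] §5 Thm. 5.4; [Kolyvagin1989Izv] Thm. B₂.
-/

set_option autoImplicit false
set_option linter.dupNamespace false -- `Summit.<P>.<Sub>` repeats `BirchSwinnertonDyer` (D-0017)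

noncomputable section

open scoped Classical

namespace Summit.BirchSwinnertonDyer.BirchSwinnertonDyer.Theorems.GenusExact.ShaCores

open WeierstrassCurve NumberField IsDedekindDomain Field AddSubgroup Literature.NumberTheory.EllipticCurves
  Literature.NumberTheory.GaloisRepresentations Literature.NumberTheory.EllipticCurves.ModularForms
  Literature.NumberTheory.EllipticCurves.RingClassField
open Summit.BirchSwinnertonDyer.BirchSwinnertonDyer.Theses.GenusKolyvaginAtTwo (KolyvaginRelationAtTwo)
open Summit.BirchSwinnertonDyer.BirchSwinnertonDyer.Theorems.GenusExact.PlusDescent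

/-! ## §1 Arithmetic in `ℤ/2^e × ℤ/2^e` -/

namespace ZModPow

/-- In `ℤ/2^e`: an element killed by `2^k` with `k + 1 ≤ e` is a double. [folklore] -/
theorem exists_two_nsmul_of_two_pow_nsmul_eq_zero {e k : ℕ} (hk : k + 1 ≤ e) (z : ZMod (2 ^ e)) (hz : 2 ^ k • z = 0) :
    ∃ z' : ZMod (2 ^ e), z = 2 • z' := by
  haveI : NeZero (2 ^ e) := ⟨pow_ne_zero _ two_ne_zero⟩
  have hcast : ((2 ^ k * z.val : ℕ) : ZMod (2 ^ e)) = 0 := by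
    rw [Nat.cast_mul, ZMod.natCast_zmod_val, ← nsmul_eq_mul]
    exact hz
  have hdvd : 2 ^ e ∣ 2 ^ k * z.val := (ZMod.natCast_eq_zero_iff _ _).mp hcast
  have h2 : 2 ^ k * 2 ∣ 2 ^ k * z.val := by
    rw [← pow_succ]
    exact (Nat.pow_dvd_pow 2 hk).trans hdvd
  obtain ⟨m, hm⟩ := Nat.dvd_of_mul_dvd_mul_left (by positivity) h2
  refine ⟨(m : ZMod (2 ^ e)), ?_⟩
  rw [← ZMod.natCast_zmod_val z, hm, Nat.cast_mul, nsmul_eq_mul]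

/-- In `ℤ/2^e × ℤ/2^e`: an element killed by `2^k` with `k + 1 ≤ e` is a double. [folklore] -/
theorem exists_two_nsmul_prod_of_two_pow_nsmul_eq_zero {e k : ℕ} (hk : k + 1 ≤ e) (g : ZMod (2 ^ e) × ZMod (2 ^ e))
    (hg : 2 ^ k • g = 0) : ∃ g' : ZMod (2 ^ e) × ZMod (2 ^ e), g = 2 • g' := by
  obtain ⟨a, ha⟩ := exists_two_nsmul_of_two_pow_nsmul_eq_zero hk g.1 (by rw [← Prod.smul_fst, hg, Prod.fst_zero])
  obtain ⟨b, hb⟩ := exists_two_nsmul_of_two_pow_nsmul_eq_zero hk g.2 (by rw [← Prod.smul_snd, hg, Prod.snd_zero])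
  exact ⟨(a, b), Prod.ext (by rw [Prod.smul_fst]; exact ha) (by rw [Prod.smul_snd]; exact hb)⟩

/-- In `ℤ/2^e × ℤ/2^e` with `1 ≤ e`: the element `(2^(e−1), 0)` is non-zero and killed by `2`. [folklore] -/
theorem two_pow_pred_ne_zero_and_two_nsmul_eq_zero {e : ℕ} (he : 1 ≤ e) :
    ((((2 ^ (e - 1) : ℕ) : ZMod (2 ^ e)), 0) : ZMod (2 ^ e) × ZMod (2 ^ e)) ≠ 0 ∧
      2 • ((((2 ^ (e - 1) : ℕ) : ZMod (2 ^ e)), 0) : ZMod (2 ^ e) × ZMod (2 ^ e)) = 0 := by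
  constructor
  · intro h
    have h1 : ((2 ^ (e - 1) : ℕ) : ZMod (2 ^ e)) = 0 := by
      have := congrArg Prod.fst h
      simpa using this
    have hdvd : 2 ^ e ∣ 2 ^ (e - 1) := (ZMod.natCast_eq_zero_iff _ _).mp h1
    have hle := (Nat.pow_dvd_pow_iff_le_right (by norm_num : 1 < 2)).mp hdvd
    omega
  · refine Prod.ext ?_ (by simp)
    rw [Prod.smul_fst, Prod.fst_zero, two_nsmul, ← Nat.cast_add, ← two_mul, ← pow_succ', Nat.sub_add_cancel he]
    exact ZMod.natCast_self _

end ZModPow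

/-! ## §2 The criterion for a pairing non-degenerate on a `2`-primary part `≃ ℤ/2^e × ℤ/2^e` -/

/-- **`B(Y[2^k], Y[2]) ≡ 0 ⟺ k + 1 ≤ e`** for the `2`-primary component `Y ≃ ℤ/2^e × ℤ/2^e` (`1 ≤ e`) of the torsion group `↥Ш(E/F)` and ANY
bi-additive alternating `B` on `↥Ш(E/F)` whose kernel is the divisible subgroup (then `B` is non-degenerate on the finite `Y`,
`OneBit.eq_zero_of_forall_apply_primaryComponent_eq_zero`).  «⇐»: an `a ∈ Y[2^k]` is a double `2a′` (`k < e`), so `B(a, b) = B(a′, 2b) = 0`;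
«⇒»: if `e ≤ k` then `Y[2^k] = Y`, and the non-zero `2`-torsion class `f⁻¹(2^(e−1), 0)` would be orthogonal to all of `Y`. [cite: Cassels1962ArithmeticIV, §1]
[cite: MilneADT2006, I Thm. 6.13] -/
theorem forall_apply_eq_zero_iff_of_addEquiv_zmod_prod {F : Type} [Field F] [NumberField F] (V : WeierstrassCurve F) [V.IsElliptic]
    [Finite (AddCommGroup.primaryComponent (↥V.sha) 2)]
    (B : ↥V.sha →+ ↥V.sha →+ AddCircle (1 : ℚ)) (halt : ∀ x, B x x = 0)
    (hker : ∀ x, (∀ y, B x y = 0) ↔ x ∈ AddSubgroup.divisibleElements (↥V.sha))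
    {e : ℕ} (he : 1 ≤ e) (f : AddCommGroup.primaryComponent (↥V.sha) 2 ≃+ ZMod (2 ^ e) × ZMod (2 ^ e)) (k : ℕ) :
    (∀ a b : ↥V.sha, 2 ^ k • a = 0 → 2 • b = 0 → B a b = 0) ↔ k + 1 ≤ e := by
  haveI : Fact (Nat.Prime 2) := ⟨Nat.prime_two⟩
  set Y : AddSubgroup ↥V.sha := AddCommGroup.primaryComponent (↥V.sha) 2 with hY
  -- antisymmetry from alternation
  have hanti : ∀ x y, B y x = -(B x y) := fun x y ↦ by
    have h := halt (x + y)
    rw [map_add, map_add B x y, AddMonoidHom.add_apply, AddMonoidHom.add_apply, halt x, halt y, zero_add, add_zero] at h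
    exact eq_neg_of_add_eq_zero_left h
  constructor
  · intro hB
    by_contra hlt
    have hek : e ≤ k := by omega
    -- the test class `b₀ = f⁻¹ (2^(e-1), 0)`
    obtain ⟨hne, h2⟩ := ZModPow.two_pow_pred_ne_zero_and_two_nsmul_eq_zero he
    set g₀ : ZMod (2 ^ e) × ZMod (2 ^ e) := ((((2 ^ (e - 1) : ℕ) : ZMod (2 ^ e)), 0)) with hg₀
    set b₀ : Y := f.symm g₀ with hb₀
    have hb₀2 : 2 • (b₀ : ↥V.sha) = 0 := by
      rw [← AddSubgroupClass.coe_nsmul, hb₀, ← map_nsmul, h2, map_zero, ZeroMemClass.coe_zero]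
    have hb₀ne : (b₀ : ↥V.sha) ≠ 0 := fun h ↦ hne (by
      have : b₀ = 0 := Subtype.ext h
      rw [hb₀, AddEquiv.map_eq_zero_iff] at this
      exact this)
    -- every `a ∈ Y` is killed by `2^k` (`e ≤ k`), hence orthogonal to `b₀`
    have horth : ∀ y ∈ Y, B (b₀ : ↥V.sha) y = 0 := by
      intro y hy
      have hy2e : 2 ^ e • (⟨y, hy⟩ : Y) = 0 := by
        rw [← f.map_eq_zero_iff, map_nsmul]
        exact (forall_nsmul_zmod_prod_eq_zero_iff e e).mpr le_rfl _
      have hyk : 2 ^ k • y = 0 := by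
        have h' : 2 ^ e • y = 0 := by
          have := congrArg Subtype.val hy2e
          rwa [AddSubgroupClass.coe_nsmul, ZeroMemClass.coe_zero] at this
        exact addOrderOf_dvd_iff_nsmul_eq_zero.mp ((addOrderOf_dvd_iff_nsmul_eq_zero.mpr h').trans (Nat.pow_dvd_pow 2 hek))
      rw [hanti, hB y (b₀ : ↥V.sha) hyk hb₀2, neg_zero]
    exact hb₀ne (OneBit.eq_zero_of_forall_apply_primaryComponent_eq_zero V.isTorsion_sha B (fun x hx ↦ (hker x).mp hx) b₀.2 horth)
  · intro hke a b ha hb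
    -- `a` is `2`-primary, so lives in `Y`; it is a double there
    have haY : a ∈ Y := (AddCommGroup.mem_primaryComponent).mpr ⟨k, ha⟩
    have hfa : 2 ^ k • f ⟨a, haY⟩ = 0 := by
      rw [← map_nsmul, AddEquiv.map_eq_zero_iff]
      exact Subtype.ext (by rw [AddSubgroupClass.coe_nsmul, ZeroMemClass.coe_zero]; exact ha)
    obtain ⟨g', hg'⟩ := ZModPow.exists_two_nsmul_prod_of_two_pow_nsmul_eq_zero hke (f ⟨a, haY⟩) hfa
    have ha2 : a = 2 • ((f.symm g' : Y) : ↥V.sha) := by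
      have h : (⟨a, haY⟩ : Y) = 2 • f.symm g' := by
        apply f.injective
        rw [map_nsmul, f.apply_symm_apply, ← hg']
      have := congrArg Subtype.val h
      rwa [AddSubgroupClass.coe_nsmul] at this
    rw [ha2, map_nsmul, AddMonoidHom.nsmul_apply, ← map_nsmul, hb, map_zero]

/-! ## §3 ★ The K₄⁺ cut cell: witness ↔ Cassels–Tate orthogonality of `Ш(E/ℚ)[2^(M₀−1)]` and `Ш(E/ℚ)[2]` (mod Q2) -/

section Cell

variable (W : WeierstrassCurve ℚ) [W.IsElliptic] [W.IsGloballyMinimal] [NeZero (W.conductorNorm ℤ)]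
variable (K : Type) [Field K] [NumberField K]

/-- ★ **THE CASSELS–TATE CRITERION FOR K₄⁺ (general `M₀`).**  On Q4_T″'s cut with the K₄⁺ cell data and `M₀ ≥ 1` (binders of
`kFourPos_witness_iff_natCard_shaPrimary_rat_eq_pow`), mod Q2: **a transposition-deep K4Pos witness EXISTS iff EVERY Cassels–Tate-type pairing `B`
on `Ш(E/ℚ)` (alternating, kernel = divisible subgroup) satisfies `B(a, b) = 0` whenever `2^(M₀−1)·a = 0` and `2·b = 0`** — at `M₀ = 2`: iff the
Cassels–Tate pairing on `Ш(E/ℚ)[2] ≅ Sel₂(E/ℚ)` is identically zero (LEAD-BRIEF-g23-ADDENDUM B.4).  = §2 on the common structure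
`Ш(E/ℚ)[2^∞] ≃ (ℤ/2^e)²`, `1 ≤ e ≤ M₀` (`exists_addEquiv_shaPrimary_of_kFourPos_cut`), with `K₄⁺ ⟺ e = M₀`
(`kFourPos_witness_iff_natCard_shaPrimary_rat_eq_pow`).  CONDITIONAL on Q2; BSD / K4Pos NOT proved by this.
[cite: Cassels1962ArithmeticIV, §1, Thm. 1.1] [cite: MilneADT2006, I Thm. 6.13] [cite: McCallumLMS1991, §5 Thm. 5.4] -/
theorem kFourPos_witness_iff_casselsTate_orthogonal (hQ2 : KolyvaginRelationAtTwo) (hcm : ¬ W.HasCM)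
    (hT : Odd W.tamagawaProduct) (v : HeightOneSpectrum (𝓞 ℚ)) (h2v : ((2 : ℕ) : 𝓞 ℚ) ∉ v.asIdeal)
    (hNv : ((W.conductorNorm ℤ : ℕ) : 𝓞 ℚ) ∈ v.asIdeal) (hmult : W.HasMultiplicativeReductionAt v) (hpos : 0 < W.Δ)
    (hIQ : IsImaginaryQuadratic K) (hodd : Odd (NumberField.discr K))
    (h3 : NumberField.discr K ≠ -3) (hHe : SatisfiesHeegnerHypothesis (W.conductorNorm ℤ) K)
    (hsq1 : ¬ IsSquare ((NumberField.discr K : ℚ) * -|W.Δ|)) (hsq2 : ¬ IsSquare ((NumberField.discr K : ℚ) * (-(2 * |W.Δ|))))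
    (hρ : ∀ n : ℕ, 0 < n → W.HasSurjectiveModNGaloisRep ((2 : ℤ) ^ n))
    (Dt : ModularParametrizationData W (W.conductorNorm ℤ)) (β : ℤ) (ι : K →+* ℂ) (d₁ : KolyvaginHeegnerData Dt β ι 1)
    (hy : ¬ IsOfFinAddOrder d₁.derivedPoint) (M₀ : ℕ) (hM₀ : 1 ≤ M₀)
    (hdiv : ∃ Q : (W.baseChange (ringClassField K ι 1)).toAffine.Point, ((2 ^ M₀ : ℕ) : ℤ) • Q = d₁.derivedPoint)
    (hndiv : ¬ ∃ Q : (W.baseChange (ringClassField K ι 1)).toAffine.Point, ((2 ^ (M₀ + 1) : ℕ) : ℤ) • Q = d₁.derivedPoint)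
    (Wd : WeierstrassCurve ℚ) [Wd.IsElliptic] [Wd.IsGloballyMinimal] (Cd : VariableChange ℚ) (hCd : Cd • W.quadraticTwist (discr K : ℚ) = Wd)
    (hSel : Nat.card (Wd.selmerGroup 2) = 2) (hDEF : padicValNat 2 Wd.tamagawaProduct = 0)
    (h4 : Nat.card (W.selmerGroup 2) = 4 ∧ ∃ c ∈ (W.kummerSelmerStructure ((2 : ℕ) : ℤ)).selmerGroup,
      galoisCohomology.localization (W.torsionGaloisModule ((2 : ℕ) : ℤ)) (Sum.inl Rat.infinitePlace) 1 c ≠ 0)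
    (hr0 : W.analyticRank = 0) (h2K : ((Ideal.span {(2 : ℤ)}).primesOver (𝓞 K)).ncard = 2) {σ₀ : K ≃ₐ[ℚ] K} (hσ₀ : σ₀ ≠ 1) :
    (∃ (n : ℕ) (d : KolyvaginHeegnerData Dt β ι n), Squarefree n ∧
      (∀ ℓ ∈ n.primeFactors, Zhang2014.IsKolyvaginPrime (W.conductorNorm ℤ) W K 2 ℓ ∧ 2 ≤ Zhang2014.kolyvaginIndex W 2 ℓ ∧
        ∃ (v : HeightOneSpectrum (𝓞 ℚ)) (𝔓 : Ideal (absIntegers (𝓞 ℚ) ℚ)) (h : absoluteGaloisGroup ℚ),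
          ((ℓ : ℕ) : 𝓞 ℚ) ∈ v.asIdeal ∧ 𝔓 ∈ v.primesAbove ∧ IsArithFrobAt (𝓞 ℚ) h 𝔓 ∧ ∃ u : W.geomTorsion ((2 : ℕ) : ℤ), h • u ≠ u) ∧
      ¬ ∃ Q : (W.baseChange (ringClassField K ι n)).toAffine.Point, (2 : ℤ) • Q = d.derivedPoint) ↔
    ∀ B : ↥W.sha →+ ↥W.sha →+ AddCircle (1 : ℚ), (∀ x, B x x = 0) → (∀ x, (∀ y, B x y = 0) ↔ x ∈ AddSubgroup.divisibleElements (↥W.sha)) →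
      ∀ a b : ↥W.sha, 2 ^ (M₀ - 1) • a = 0 → 2 • b = 0 → B a b = 0 := by
  obtain ⟨e, he1, heM, -, ⟨f⟩, -, hYe⟩ := exists_addEquiv_shaPrimary_of_kFourPos_cut W K hQ2 hcm hT v h2v hNv hmult hpos hIQ hodd h3 hHe hsq1
    hsq2 hρ Dt β ι d₁ hy M₀ hdiv hndiv Wd Cd hCd hSel hDEF h4 hr0 h2K hσ₀
  haveI : Finite (AddCommGroup.primaryComponent (↥W.sha) 2) := Nat.finite_of_card_ne_zero (by rw [hYe]; positivity)
  rw [kFourPos_witness_iff_natCard_shaPrimary_rat_eq_pow W K hQ2 hcm hT v h2v hNv hmult hpos hIQ hodd h3 hHe hsq1 hsq2 hρ Dt β ι d₁ hy M₀ hM₀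
    hdiv hndiv Wd Cd hCd hSel hDEF h4 hr0 h2K hσ₀, hYe]
  have hiff : 4 ^ e = 4 ^ M₀ ↔ M₀ - 1 + 1 ≤ e := by
    rw [Nat.sub_add_cancel hM₀]
    constructor
    · intro h; exact (Nat.pow_right_injective (by norm_num : 2 ≤ 4) h).ge
    · intro h; rw [le_antisymm heM h]
  rw [hiff]
  constructor
  · intro hle B halt hker
    exact (forall_apply_eq_zero_iff_of_addEquiv_zmod_prod W B halt hker he1 f (M₀ - 1)).mpr hle
  · intro hB
    obtain ⟨B, halt, hker⟩ := WeierstrassCurve.exists_casselsTate_pairing_holds (K := ℚ) W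
    exact (forall_apply_eq_zero_iff_of_addEquiv_zmod_prod W B halt hker he1 f (M₀ - 1)).mp (hB B halt hker)

/-- **The same with ONE Cassels–Tate-type pairing**: a K4Pos witness exists iff SOME alternating pairing on `Ш(E/ℚ)` with kernel the divisible
subgroup is orthogonal between `Ш(E/ℚ)[2^(M₀−1)]` and `Ш(E/ℚ)[2]` (the tree's Cassels–Tate pairing `exists_casselsTate_pairing_holds` is such a
pairing, so «every» and «some» agree).  CONDITIONAL on Q2; BSD / K4Pos NOT proved by this. [cite: Cassels1962ArithmeticIV, §1] [cite: MilneADT2006, I Thm. 6.13] -/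
theorem kFourPos_witness_iff_exists_casselsTate_orthogonal (hQ2 : KolyvaginRelationAtTwo) (hcm : ¬ W.HasCM)
    (hT : Odd W.tamagawaProduct) (v : HeightOneSpectrum (𝓞 ℚ)) (h2v : ((2 : ℕ) : 𝓞 ℚ) ∉ v.asIdeal)
    (hNv : ((W.conductorNorm ℤ : ℕ) : 𝓞 ℚ) ∈ v.asIdeal) (hmult : W.HasMultiplicativeReductionAt v) (hpos : 0 < W.Δ)
    (hIQ : IsImaginaryQuadratic K) (hodd : Odd (NumberField.discr K))
    (h3 : NumberField.discr K ≠ -3) (hHe : SatisfiesHeegnerHypothesis (W.conductorNorm ℤ) K)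
    (hsq1 : ¬ IsSquare ((NumberField.discr K : ℚ) * -|W.Δ|)) (hsq2 : ¬ IsSquare ((NumberField.discr K : ℚ) * (-(2 * |W.Δ|))))
    (hρ : ∀ n : ℕ, 0 < n → W.HasSurjectiveModNGaloisRep ((2 : ℤ) ^ n))
    (Dt : ModularParametrizationData W (W.conductorNorm ℤ)) (β : ℤ) (ι : K →+* ℂ) (d₁ : KolyvaginHeegnerData Dt β ι 1)
    (hy : ¬ IsOfFinAddOrder d₁.derivedPoint) (M₀ : ℕ) (hM₀ : 1 ≤ M₀)
    (hdiv : ∃ Q : (W.baseChange (ringClassField K ι 1)).toAffine.Point, ((2 ^ M₀ : ℕ) : ℤ) • Q = d₁.derivedPoint)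
    (hndiv : ¬ ∃ Q : (W.baseChange (ringClassField K ι 1)).toAffine.Point, ((2 ^ (M₀ + 1) : ℕ) : ℤ) • Q = d₁.derivedPoint)
    (Wd : WeierstrassCurve ℚ) [Wd.IsElliptic] [Wd.IsGloballyMinimal] (Cd : VariableChange ℚ) (hCd : Cd • W.quadraticTwist (discr K : ℚ) = Wd)
    (hSel : Nat.card (Wd.selmerGroup 2) = 2) (hDEF : padicValNat 2 Wd.tamagawaProduct = 0)
    (h4 : Nat.card (W.selmerGroup 2) = 4 ∧ ∃ c ∈ (W.kummerSelmerStructure ((2 : ℕ) : ℤ)).selmerGroup,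
      galoisCohomology.localization (W.torsionGaloisModule ((2 : ℕ) : ℤ)) (Sum.inl Rat.infinitePlace) 1 c ≠ 0)
    (hr0 : W.analyticRank = 0) (h2K : ((Ideal.span {(2 : ℤ)}).primesOver (𝓞 K)).ncard = 2) {σ₀ : K ≃ₐ[ℚ] K} (hσ₀ : σ₀ ≠ 1) :
    (∃ (n : ℕ) (d : KolyvaginHeegnerData Dt β ι n), Squarefree n ∧
      (∀ ℓ ∈ n.primeFactors, Zhang2014.IsKolyvaginPrime (W.conductorNorm ℤ) W K 2 ℓ ∧ 2 ≤ Zhang2014.kolyvaginIndex W 2 ℓ ∧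
        ∃ (v : HeightOneSpectrum (𝓞 ℚ)) (𝔓 : Ideal (absIntegers (𝓞 ℚ) ℚ)) (h : absoluteGaloisGroup ℚ),
          ((ℓ : ℕ) : 𝓞 ℚ) ∈ v.asIdeal ∧ 𝔓 ∈ v.primesAbove ∧ IsArithFrobAt (𝓞 ℚ) h 𝔓 ∧ ∃ u : W.geomTorsion ((2 : ℕ) : ℤ), h • u ≠ u) ∧
      ¬ ∃ Q : (W.baseChange (ringClassField K ι n)).toAffine.Point, (2 : ℤ) • Q = d.derivedPoint) ↔
    ∃ B : ↥W.sha →+ ↥W.sha →+ AddCircle (1 : ℚ), (∀ x, B x x = 0) ∧ (∀ x, (∀ y, B x y = 0) ↔ x ∈ AddSubgroup.divisibleElements (↥W.sha)) ∧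
      ∀ a b : ↥W.sha, 2 ^ (M₀ - 1) • a = 0 → 2 • b = 0 → B a b = 0 := by
  obtain ⟨e, he1, heM, -, ⟨f⟩, -, hYe⟩ := exists_addEquiv_shaPrimary_of_kFourPos_cut W K hQ2 hcm hT v h2v hNv hmult hpos hIQ hodd h3 hHe hsq1
    hsq2 hρ Dt β ι d₁ hy M₀ hdiv hndiv Wd Cd hCd hSel hDEF h4 hr0 h2K hσ₀
  haveI : Finite (AddCommGroup.primaryComponent (↥W.sha) 2) := Nat.finite_of_card_ne_zero (by rw [hYe]; positivity)
  rw [kFourPos_witness_iff_casselsTate_orthogonal W K hQ2 hcm hT v h2v hNv hmult hpos hIQ hodd h3 hHe hsq1 hsq2 hρ Dt β ι d₁ hy M₀ hM₀ hdiv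
    hndiv Wd Cd hCd hSel hDEF h4 hr0 h2K hσ₀]
  obtain ⟨B₀, halt₀, hker₀⟩ := WeierstrassCurve.exists_casselsTate_pairing_holds (K := ℚ) W
  constructor
  · intro h; exact ⟨B₀, halt₀, hker₀, h B₀ halt₀ hker₀⟩
  · rintro ⟨B, halt, hker, hB⟩ B' halt' hker'
    have hle := (forall_apply_eq_zero_iff_of_addEquiv_zmod_prod W B halt hker he1 f (M₀ - 1)).mp hB
    exact (forall_apply_eq_zero_iff_of_addEquiv_zmod_prod W B' halt' hker' he1 f (M₀ - 1)).mpr hle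

end Cell

/-! ## §4 The Δ < 0 cut cell in exponent form: `e = M₀ ↔` Cassels–Tate orthogonality -/

section CellNeg

variable (W : WeierstrassCurve ℚ) [W.IsElliptic] [W.IsGloballyMinimal] [NeZero (W.conductorNorm ℤ)]
variable (K : Type) [Field K] [NumberField K]

/-- **Δ < 0 (K₄ cut cell), exponent form**: for the common block exponent `e` of `exists_addEquiv_shaPrimary_of_kFourNeg_cut` (`1 ≤ e ≤ M₀`,
`#Ш(E/ℚ)[2^∞] = 4^e`), mod Q2: **`#Ш(E/ℚ)[2^∞] = 4^(M₀)` iff every Cassels–Tate-type pairing is orthogonal between `Ш(E/ℚ)[2^(M₀−1)]` and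
`Ш(E/ℚ)[2]`**; by the LEAD's `KFourCell.ShaCardCurrency.kFourNeg_conclusion_iff_natCard_sha_rat_eq_pow` (p773559) the left side is K4Neg at `E`.
CONDITIONAL on Q2; BSD / K4Neg NOT proved by this. [cite: Cassels1962ArithmeticIV, §1] [cite: MilneADT2006, I Thm. 6.13] -/
theorem natCard_shaPrimary_rat_eq_pow_iff_casselsTate_orthogonal_of_kFourNeg_cut (hQ2 : KolyvaginRelationAtTwo) (hcm : ¬ W.HasCM)
    (hT : Odd W.tamagawaProduct) (v : HeightOneSpectrum (𝓞 ℚ)) (h2v : ((2 : ℕ) : 𝓞 ℚ) ∉ v.asIdeal)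
    (hNv : ((W.conductorNorm ℤ : ℕ) : 𝓞 ℚ) ∈ v.asIdeal) (hmult : W.HasMultiplicativeReductionAt v) (hΔ : W.Δ < 0)
    (hIQ : IsImaginaryQuadratic K) (hodd : Odd (NumberField.discr K))
    (h3 : NumberField.discr K ≠ -3) (hHe : SatisfiesHeegnerHypothesis (W.conductorNorm ℤ) K)
    (hsq1 : ¬ IsSquare ((NumberField.discr K : ℚ) * -|W.Δ|)) (hsq2 : ¬ IsSquare ((NumberField.discr K : ℚ) * (-(2 * |W.Δ|))))
    (hρ : ∀ n : ℕ, 0 < n → W.HasSurjectiveModNGaloisRep ((2 : ℤ) ^ n))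
    (Dt : ModularParametrizationData W (W.conductorNorm ℤ)) (β : ℤ) (ι : K →+* ℂ) (d₁ : KolyvaginHeegnerData Dt β ι 1)
    (hy : ¬ IsOfFinAddOrder d₁.derivedPoint) (M₀ : ℕ) (hM₀ : 1 ≤ M₀)
    (hdiv : ∃ Q : (W.baseChange (ringClassField K ι 1)).toAffine.Point, ((2 ^ M₀ : ℕ) : ℤ) • Q = d₁.derivedPoint)
    (hndiv : ¬ ∃ Q : (W.baseChange (ringClassField K ι 1)).toAffine.Point, ((2 ^ (M₀ + 1) : ℕ) : ℤ) • Q = d₁.derivedPoint)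
    (Wd : WeierstrassCurve ℚ) [Wd.IsElliptic] (hWd : ∃ C : VariableChange ℚ, C • W.quadraticTwist (discr K : ℚ) = Wd)
    (hSel : Nat.card (Wd.selmerGroup 2) = 2) (hDEF : padicValNat 2 Wd.tamagawaProduct ≤ 1)
    (h4 : Nat.card (W.selmerGroup 2) = 4) (hr0 : W.analyticRank = 0)
    (h2K : ((Ideal.span {(2 : ℤ)}).primesOver (𝓞 K)).ncard = 2) {ℓ₀ : ℕ} [Fact ℓ₀.Prime] (hd : discr K = -(ℓ₀ : ℤ))
    {σ₀ : K ≃ₐ[ℚ] K} (hσ₀ : σ₀ ≠ 1) :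
    Nat.card (AddCommGroup.primaryComponent (↥W.sha) 2) = 4 ^ M₀ ↔
    ∀ B : ↥W.sha →+ ↥W.sha →+ AddCircle (1 : ℚ), (∀ x, B x x = 0) → (∀ x, (∀ y, B x y = 0) ↔ x ∈ AddSubgroup.divisibleElements (↥W.sha)) →
      ∀ a b : ↥W.sha, 2 ^ (M₀ - 1) • a = 0 → 2 • b = 0 → B a b = 0 := by
  obtain ⟨e, he1, heM, -, ⟨f⟩, -, hYe⟩ := exists_addEquiv_shaPrimary_of_kFourNeg_cut W K hQ2 hcm hT v h2v hNv hmult hΔ hIQ hodd h3 hHe hsq1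
    hsq2 hρ Dt β ι d₁ hy M₀ hdiv hndiv Wd hWd hSel hDEF h4 hr0 h2K hd hσ₀
  haveI : Finite (AddCommGroup.primaryComponent (↥W.sha) 2) := Nat.finite_of_card_ne_zero (by rw [hYe]; positivity)
  rw [hYe]
  have hiff : 4 ^ e = 4 ^ M₀ ↔ M₀ - 1 + 1 ≤ e := by
    rw [Nat.sub_add_cancel hM₀]
    constructor
    · intro h; exact (Nat.pow_right_injective (by norm_num : 2 ≤ 4) h).ge
    · intro h; rw [le_antisymm heM h]
  rw [hiff]
  constructor
  · intro hle B halt hker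
    exact (forall_apply_eq_zero_iff_of_addEquiv_zmod_prod W B halt hker he1 f (M₀ - 1)).mpr hle
  · intro hB
    obtain ⟨B, halt, hker⟩ := WeierstrassCurve.exists_casselsTate_pairing_holds (K := ℚ) W
    exact (forall_apply_eq_zero_iff_of_addEquiv_zmod_prod W B halt hker he1 f (M₀ - 1)).mp (hB B halt hker)

/-- ★ **THE CASSELS–TATE CRITERION FOR K₄ (Δ < 0), K4Neg-binder face** (LEAD g24's GO, bus 13:17Z): on K4Neg's frame VERBATIM + one odd
multiplicative prime `v` (the cut), mod Q2: **K4Neg's conclusion (a square-free `n` of `FrobEqFrobInfty` Kolyvagin primes of index `≥ 2` with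
`P(n) ∉ 2E(K[n])`) holds iff every Cassels–Tate-type pairing on `Ш(E/ℚ)` is orthogonal between `Ш(E/ℚ)[2^(M₀−1)]` and `Ш(E/ℚ)[2]`** — the LEAD's
`KFourCell.ShaCardCurrency.kFourNeg_conclusion_iff_natCard_sha_rat_eq_pow` (p773559: ⟺ `#Ш(E/ℚ)[2^∞] = 2^(2M₀)`) composed with
`natCard_shaPrimary_rat_eq_pow_iff_casselsTate_orthogonal_of_kFourNeg_cut`.  At `M₀ = 2`: K4Neg at `E` ⟺ Cassels–Tate `≡ 0` on `Ш(E/ℚ)[2]`.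
CONDITIONAL on Q2; BSD / K4Neg NOT proved by this. [cite: Cassels1962ArithmeticIV, §1, Thm. 1.1] [cite: McCallumLMS1991, §5 Thm. 5.4] -/
theorem kFourNeg_witness_iff_casselsTate_orthogonal (hQ2 : KolyvaginRelationAtTwo) (hcm : ¬ W.HasCM)
    (hr0 : W.analyticRank = 0) (hρ : ∀ n : ℕ, 0 < n → W.HasSurjectiveModNGaloisRep ((2 : ℤ) ^ n)) (hT : Odd W.tamagawaProduct)
    (hneg : W.Δ < 0) (h4 : Nat.card (W.selmerGroup 2) = 4)
    (hIQ : IsImaginaryQuadratic K) (hodd : Odd (NumberField.discr K))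
    (h3 : NumberField.discr K ≠ -3) (hHe : SatisfiesHeegnerHypothesis (W.conductorNorm ℤ) K)
    (hsq1 : ¬ IsSquare ((NumberField.discr K : ℚ) * -|W.Δ|)) (hsq2 : ¬ IsSquare ((NumberField.discr K : ℚ) * (-(2 * |W.Δ|))))
    (ℓ₀ : ℕ) (hℓ₀ : ℓ₀.Prime) (hdK : NumberField.discr K = -(ℓ₀ : ℤ))
    (h2K : ((Ideal.span {(2 : ℤ)}).primesOver (𝓞 K)).ncard = 2)
    (Dt : ModularParametrizationData W (W.conductorNorm ℤ))
    (hopt : ∀ z ∈ Dt.L.lattice, ∃ w ∈ periodLattice Dt.f, z = (Dt.c : ℂ) * w) (hc : Odd Dt.c)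
    (β : ℤ) (ι : K →+* ℂ) (d₁ : KolyvaginHeegnerData Dt β ι 1) (hy : ¬ IsOfFinAddOrder d₁.derivedPoint) (M₀ : ℕ)
    (hdiv : ∃ Q : (W.baseChange (ringClassField K ι 1)).toAffine.Point, ((2 ^ M₀ : ℕ) : ℤ) • Q = d₁.derivedPoint)
    (hndiv : ¬ ∃ Q : (W.baseChange (ringClassField K ι 1)).toAffine.Point, ((2 ^ (M₀ + 1) : ℕ) : ℤ) • Q = d₁.derivedPoint)
    (hM₀ : 1 ≤ M₀) (Wd : WeierstrassCurve ℚ) [Wd.IsElliptic] [Wd.IsGloballyMinimal]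
    (hWd : ∃ C : VariableChange ℚ, C • W.quadraticTwist (NumberField.discr K : ℚ) = Wd) (hrd : Wd.analyticRank = 1)
    (hSel : Nat.card (Wd.selmerGroup 2) = 2) (hDEF : padicValNat 2 Wd.tamagawaProduct ≤ 1)
    (v : HeightOneSpectrum (𝓞 ℚ)) (h2v : ((2 : ℕ) : 𝓞 ℚ) ∉ v.asIdeal) (hNv : ((W.conductorNorm ℤ : ℕ) : 𝓞 ℚ) ∈ v.asIdeal)
    (hmult : W.HasMultiplicativeReductionAt v) :
    (∃ (n : ℕ) (d : KolyvaginHeegnerData Dt β ι n), Squarefree n ∧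
      (∀ ℓ ∈ n.primeFactors, Zhang2014.IsKolyvaginPrime (W.conductorNorm ℤ) W K 2 ℓ ∧ 2 ≤ Zhang2014.kolyvaginIndex W 2 ℓ ∧
        FrobEqFrobInfty W K 2 ℓ) ∧
      ¬ ∃ Q : (W.baseChange (ringClassField K ι n)).toAffine.Point, (2 : ℤ) • Q = d.derivedPoint) ↔
    ∀ B : ↥W.sha →+ ↥W.sha →+ AddCircle (1 : ℚ), (∀ x, B x x = 0) → (∀ x, (∀ y, B x y = 0) ↔ x ∈ AddSubgroup.divisibleElements (↥W.sha)) →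
      ∀ a b : ↥W.sha, 2 ^ (M₀ - 1) • a = 0 → 2 • b = 0 → B a b = 0 := by
  haveI : Fact ℓ₀.Prime := ⟨hℓ₀⟩
  -- a non-trivial automorphism of the quadratic field `K`
  haveI : Algebra.IsQuadraticExtension ℚ K := ⟨hIQ.1⟩
  have hcard : Nat.card (K ≃ₐ[ℚ] K) = 2 := by rw [IsGalois.card_aut_eq_finrank, hIQ.1]
  obtain ⟨σ₀, hσ₀⟩ : ∃ τ : K ≃ₐ[ℚ] K, τ ≠ 1 := by
    by_contra h
    have hsub : Subsingleton (K ≃ₐ[ℚ] K) := ⟨fun a b ↦ by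
      have ha : a = 1 := not_not.mp fun ha ↦ h ⟨a, ha⟩
      have hb : b = 1 := not_not.mp fun hb ↦ h ⟨b, hb⟩
      rw [ha, hb]⟩
    have h1 : Nat.card (K ≃ₐ[ℚ] K) ≤ 1 := Finite.card_le_one_iff_subsingleton.mpr hsub
    omega
  rw [GenusSupplyNarrow.KFourCell.ShaCardCurrency.kFourNeg_conclusion_iff_natCard_sha_rat_eq_pow hQ2 W hcm hr0 hρ hT hneg h4 K hIQ hodd h3 hHe
    hsq1 hsq2 ℓ₀ hℓ₀ hdK h2K Dt hopt hc β ι d₁ hy M₀ hdiv hndiv hM₀ Wd hWd hrd hSel hDEF v h2v hNv hmult,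
    ← natCard_shaPrimary_rat_eq_pow_iff_casselsTate_orthogonal_of_kFourNeg_cut W K hQ2 hcm hT v h2v hNv hmult hneg hIQ hodd h3 hHe hsq1 hsq2
      hρ Dt β ι d₁ hy M₀ hM₀ hdiv hndiv Wd hWd hSel hDEF h4 hr0 h2K hdK hσ₀, pow_mul]
  norm_num

end CellNeg

end Summit.BirchSwinnertonDyer.BirchSwinnertonDyer.Theorems.GenusExact.ShaCores

end
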